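import Mathlib
import HarnessLib
import Literature.Analysis.FluidPDE.SuitableWeak
import Literature.Analysis.FluidPDE.SpaceTimeMollifier

/-!
# Constant slices from a vanishing weak spatial gradient (line dissipation-quantum-tolerance,
# crux ApexLocalisation, stub `stub_sliceConstant`)

`stub_sliceConstant`: a field `u : ℝ → ℝ³ → ℝ³` continuous on the open backward slab
`(-∞, 0) × ℝ³` whose weak spatial gradient (accepted `HasWeakSpatialGradientOn`) VANISHES on the
open unit band `Q = Q_{1/2}(-1/4, 0) = (-1/2, -1/4) × B_{1/2}(0)` has slices `u(t, ·)` constant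
on `B_{1/2}(0)` for every `t ∈ (-1/2, -1/4)`.

Proof (Evans, *PDE*, §5.3.1 Thm. 1, `D(η_ε ⋆ u) = η_ε ⋆ Du`, plus a limit): fix `t₀`, `x₁`, `y₁`.
A margin `m > 0` keeps the closed space–time balls of radius `≤ m/4` centred on
`{t₀} × B_{1/2 - m/2}(0) ∋ (t₀, x₁), (t₀, y₁)` inside `Q` (`closedBall_subset_unitBand`). For a
mollifier sequence `φₙ` (tree `FunctionSpaces.exists_contDiffBump_seq`) and `n` large, the tree's
`HasWeakSpatialGradientOn.fderiv_mollified` gives `D_x(φₙ ⋆ 𝟙_Q u)(t₀, ·) = φₙ ⋆ 𝟙_Q 0 = 0` on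
the ball `B_{1/2 - m/2}(0)`, so the smooth slice is constant there (Mathlib
`IsOpen.is_const_of_fderiv_eq_zero`): `(φₙ ⋆ 𝟙_Q u)(t₀, x₁) = (φₙ ⋆ 𝟙_Q u)(t₀, y₁)`. As `n → ∞`
the two sides tend to `u(t₀, x₁)` and `u(t₀, y₁)` (Mathlib `ContDiffBump.convolution_tendsto_right`
at the continuity points `(t₀, x₁), (t₀, y₁) ∈ Q` of `𝟙_Q u`), whence `u(t₀, x₁) = u(t₀, y₁)` by
uniqueness of limits.

## References

* L. C. Evans, *Partial Differential Equations*, 2nd ed., AMS (2010), §5.3.1 Thm. 1 and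
  App. C.4 Thm. 7. [Evans2010]
-/

set_option linter.dupNamespace false

namespace Summit.NavierStokesRegularity.NavierStokesRegularity.Theorems.RellichScarApexLocalisation

open MeasureTheory Set Function Metric Filter Topology TopologicalSpace
open scoped ENNReal NNReal
open Literature.Analysis Literature.Analysis.FluidPDE

local notation "E³" => EuclideanSpace ℝ (Fin 3)

/-- **Mollifying the zero extension of the zero field gives zero**: `(k ⋆ 𝟙_Q 0)(t, x) = 0`. -/
theorem stMollify_zeroExt_zero {E : Type*} [NormedAddCommGroup E] [InnerProductSpace ℝ E]
    [FiniteDimensional ℝ E] [MeasurableSpace E] [BorelSpace E] {F : Type*} [NormedAddCommGroup F]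
    [NormedSpace ℝ F] (Q : Opens (ℝ × E)) (k : ℝ × E → ℝ) (t : ℝ) (x : E) :
    stMollify k (zeroExt Q (0 : ℝ → E → F)) t x = 0 := by
  have h0 : zeroExt Q (0 : ℝ → E → F) = 0 := by
    funext z
    by_cases hz : z ∈ (Q : Set (ℝ × E))
    · rw [zeroExt_of_mem _ hz]; rfl
    · rw [zeroExt_of_not_mem _ hz]; rfl
  rw [h0, stMollify_apply, convolution_zero]
  rfl

/-- **Margin of the unit band.** If `0 < m ≤ t₀ + 1/2`, `m ≤ -1/4 - t₀`, `ε ≤ m/4` and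
`‖x‖ < 1/2 - m/2`, then the closed space–time ball `closedBall (t₀, x) ε` (sup metric on
`ℝ × ℝ³`) lies in the open band `(-1/2, -1/4) × B_{1/2}(0)`. -/
theorem closedBall_subset_unitBand {t₀ m ε : ℝ} (hm : 0 < m) (hm₁ : m ≤ t₀ + 1 / 2)
    (hm₂ : m ≤ -(1 / 4) - t₀) (hε : ε ≤ m / 4) {x : E³}
    (hx : x ∈ ball (0 : E³) (1 / 2 - m / 2)) :
    closedBall ((t₀, x) : ℝ × E³) ε ⊆ Ioo (-(1 / 2) : ℝ) (-(1 / 4)) ×ˢ ball (0 : E³) (1 / 2) := by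
  intro z hz
  rw [← closedBall_prod_same, mem_prod, mem_closedBall, mem_closedBall, Real.dist_eq,
    dist_eq_norm] at hz
  obtain ⟨h1, h2⟩ := hz
  rw [abs_le] at h1
  rw [mem_ball, dist_zero_right] at hx
  have h3 := norm_sub_norm_le z.2 x
  rw [mem_prod, mem_Ioo, mem_ball, dist_zero_right]
  exact ⟨⟨by linarith, by linarith⟩, by linarith⟩

/-- **S1, CONSTANT SLICES** (Evans, *PDE* §5.3.1 Thm 1 `D(η_ε ⋆ u) = η_ε ⋆ Du`; tree
`HasWeakSpatialGradientOn.fderiv_mollified`): a field continuous on the open slab whose weak spatial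
gradient vanishes on the open unit band `Q((−1/4,0),1/2) = (−1/2,−1/4) × B_{1/2}(0)` has slices
constant on `B_{1/2}(0)` at every time of the band (mollify, differentiate, let the mollifier shrink:
the mollified slices are constant on inner balls and converge to the continuous field pointwise).
[cite: Evans2010, §5.3.1 Thm. 1] -/
theorem stub_sliceConstant :
    ∀ (u : ℝ → E³ → E³), ContinuousOn (uncurry u) (Iio (0 : ℝ) ×ˢ univ) →
      HasWeakSpatialGradientOn (parabolicCylinderOpens (1 / 2 : ℝ) ((-(1 / 4) : ℝ), (0 : E³))) u 0 →
      ∀ t ∈ Ioo (-(1 / 2) : ℝ) (-(1 / 4)), ∀ x ∈ ball (0 : E³) (1 / 2), ∀ y ∈ ball (0 : E³) (1 / 2),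
        u t x = u t y := by
  intro u hcont hG t₀ ht₀ x₁ hx₁ y₁ hy₁
  haveI : (volume : Measure (ℝ × E³)).IsAddHaarMeasure := Measure.prod.instIsAddHaarMeasure _ _
  set Q : Opens (ℝ × E³) := parabolicCylinderOpens (1 / 2 : ℝ) ((-(1 / 4) : ℝ), (0 : E³))
    with hQdef
  have hQset : (Q : Set (ℝ × E³)) = Ioo (-(1 / 2) : ℝ) (-(1 / 4)) ×ˢ ball (0 : E³) (1 / 2) := by
    rw [hQdef, coe_parabolicCylinderOpens, parabolicCylinder]
    norm_num
  -- (1) `u` is integrable on `Q`: continuous on the compact closure, which lies in the slab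
  have hK : IsCompact (Icc (-(1 / 2) : ℝ) (-(1 / 4)) ×ˢ closedBall (0 : E³) (1 / 2)) :=
    isCompact_Icc.prod (isCompact_closedBall _ _)
  have hKslab : Icc (-(1 / 2) : ℝ) (-(1 / 4)) ×ˢ closedBall (0 : E³) (1 / 2) ⊆
      Iio (0 : ℝ) ×ˢ univ :=
    prod_mono (fun s hs => mem_Iio.2 (lt_of_le_of_lt hs.2 (by norm_num))) (subset_univ _)
  have hu : IntegrableOn (uncurry u) (Q : Set (ℝ × E³)) volume := by
    refine ((hcont.mono hKslab).integrableOn_compact hK).mono_set ?_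
    rw [hQset]
    exact prod_mono Ioo_subset_Icc_self ball_subset_closedBall
  have hGi : IntegrableOn (uncurry (0 : ℝ → E³ → E³ →L[ℝ] E³)) (Q : Set (ℝ × E³)) volume := by
    have h0 : uncurry (0 : ℝ → E³ → E³ →L[ℝ] E³) = fun _ => 0 := by funext z; rfl
    rw [h0]
    exact (integrable_zero (ℝ × E³) (E³ →L[ℝ] E³) volume).integrableOn
  have hgli : LocallyIntegrable (zeroExt Q u) volume := locallyIntegrable_zeroExt hu
  have hgm : AEStronglyMeasurable (zeroExt Q u) volume :=
    (integrable_zeroExt hu).aestronglyMeasurable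
  -- (2) the margin `m` and the ball `S = B_{1/2 - m/2}(0) ∋ x₁, y₁`
  rw [mem_ball, dist_zero_right] at hx₁ hy₁
  set m : ℝ := min (min (t₀ + 1 / 2) (-(1 / 4) - t₀)) (1 / 2 - max ‖x₁‖ ‖y₁‖) with hmdef
  have hm : 0 < m :=
    lt_min (lt_min (by linarith [ht₀.1]) (by linarith [ht₀.2])) (sub_pos.2 (max_lt hx₁ hy₁))
  have hm₁ : m ≤ t₀ + 1 / 2 := (min_le_left _ _).trans (min_le_left _ _)
  have hm₂ : m ≤ -(1 / 4) - t₀ := (min_le_left _ _).trans (min_le_right _ _)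
  have hm₃ : m ≤ 1 / 2 - max ‖x₁‖ ‖y₁‖ := min_le_right _ _
  have hx₁S : x₁ ∈ ball (0 : E³) (1 / 2 - m / 2) := by
    rw [mem_ball, dist_zero_right]; linarith [le_max_left ‖x₁‖ ‖y₁‖]
  have hy₁S : y₁ ∈ ball (0 : E³) (1 / 2 - m / 2) := by
    rw [mem_ball, dist_zero_right]; linarith [le_max_right ‖x₁‖ ‖y₁‖]
  have hSQ : ∀ x ∈ ball (0 : E³) (1 / 2 - m / 2), ((t₀, x) : ℝ × E³) ∈ (Q : Set (ℝ × E³)) := by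
    intro x hx
    rw [hQset]
    refine mk_mem_prod ht₀ ?_
    rw [mem_ball, dist_zero_right] at hx ⊢
    linarith
  -- (3) the mollifiers `φₙ.normed`, supported in `closedBall 0 (φₙ.rOut)`, `φₙ.rOut → 0`
  obtain ⟨φ, hφ, -⟩ := FunctionSpaces.exists_contDiffBump_seq (E := ℝ × E³)
  have hk : ∀ n, ContDiff ℝ (⊤ : ℕ∞) ((φ n).normed volume) := fun n => (φ n).contDiff_normed
  have hkr : ∀ n w, w ∉ closedBall (0 : ℝ × E³) (φ n).rOut → (φ n).normed volume w = 0 := by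
    intro n w hw
    rw [mem_closedBall, not_le] at hw
    rw [ContDiffBump.normed_def, (φ n).zero_of_le_dist hw.le, zero_div]
  have hkc : ∀ n, HasCompactSupport ((φ n).normed volume) := fun n =>
    hasCompactSupport_of_closedBall (hkr n)
  -- (4) for large `n` the mollified slice has zero derivative on `S`, hence is constant there
  have hev : ∀ᶠ n in atTop, (φ n).rOut < m / 4 := (tendsto_order.1 hφ).2 _ (by linarith)
  have hconst : ∀ᶠ n in atTop, stMollify ((φ n).normed volume) (zeroExt Q u) t₀ x₁ =
      stMollify ((φ n).normed volume) (zeroExt Q u) t₀ y₁ := by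
    filter_upwards [hev] with n hn
    have hD : ∀ x ∈ ball (0 : E³) (1 / 2 - m / 2),
        fderiv ℝ (stMollify ((φ n).normed volume) (zeroExt Q u) t₀) x = 0 := by
      intro x hx
      have hQb : closedBall ((t₀, x) : ℝ × E³) (φ n).rOut ⊆ (Q : Set (ℝ × E³)) := by
        rw [hQset]
        exact closedBall_subset_unitBand hm hm₁ hm₂ hn.le hx
      rw [hG.fderiv_mollified hu hGi (hk n) (hkr n) hQb]
      exact stMollify_zeroExt_zero _ _ _ _
    have hdiff : Differentiable ℝ (stMollify ((φ n).normed volume) (zeroExt Q u) t₀) :=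
      (contDiff_stMollify_slice (hk n) (hkc n) hgli t₀).differentiable (by simp)
    exact isOpen_ball.is_const_of_fderiv_eq_zero (convex_ball _ _).isPreconnected
      hdiff.differentiableOn (fun x hx => hD x hx) hx₁S hy₁S
  -- (5) the mollified slices converge to `u (t₀, ·)` at the points of `S` (continuity points)
  have hlim : ∀ x ∈ ball (0 : E³) (1 / 2 - m / 2),
      Tendsto (fun n => stMollify ((φ n).normed volume) (zeroExt Q u) t₀ x) atTop
        (𝓝 (u t₀ x)) := by
    intro x hx
    have hzQ := hSQ x hx
    have hca : ContinuousAt (uncurry u) (t₀, x) :=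
      hcont.continuousAt ((isOpen_Iio.prod isOpen_univ).mem_nhds
        ⟨mem_Iio.2 (ht₀.2.trans (by norm_num)), mem_univ _⟩)
    have hcg : ContinuousAt (zeroExt Q u) (t₀, x) :=
      hca.congr_of_eventuallyEq (eventuallyEq_of_mem (Q.isOpen.mem_nhds hzQ)
        fun z hz => zeroExt_of_mem u hz)
    have h := ContDiffBump.convolution_tendsto_right (μ := volume) (g := fun _ => zeroExt Q u)
      (k := fun _ => ((t₀, x) : ℝ × E³)) hφ (Eventually.of_forall fun _ => hgm)
      (hcg.tendsto.comp tendsto_snd) tendsto_const_nhds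
    rw [zeroExt_of_mem u hzQ] at h
    exact h
  -- (6) uniqueness of limits
  exact tendsto_nhds_unique_of_eventuallyEq (hlim x₁ hx₁S) (hlim y₁ hy₁S) hconst

end Summit.NavierStokesRegularity.NavierStokesRegularity.Theorems.RellichScarApexLocalisation
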